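import Summits.QuantumFields.BalabanUV.T4Continuum.Support.NE7EffectiveFormLowerBoundSocket
import Summits.QuantumFields.BalabanUV.T4Continuum.Support.NE7StrippedMultiplierLetterL1
import Summits.QuantumFields.BalabanUV.T4Continuum.Support.NE7MultiplierDensity
import HarnessLib

/-!
# NE7EffectiveFormLowerBound — (G′) FOR d = 4, j- AND N-UNIFORM: THE HESSIAN OF THE CONSTRAINED MINIMAL ACTION AT A MINIMISER DOMINATES `(1 − O(ε))·w·Σ_P nhs(curl_{V₀} ṽ)` UP TO AN
# `O(ε)·w·‖ṽ‖²` MASS TERM (lineage `b2b-balaban-t4-ne7-p1`, gen 119, file H15 = ROAD-G119 §5 S5′: the local stripped multiplier letter × the multiplier density, fed to H11)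

Cell `pub-balaban`, rung (B)+1 sub-cell t4, CRUX PROVER NE7 #1 (OWNER of row NE7), generation 119.
WHY (memo ROAD-G119).  (G′) is row NE7's effective-form lower bound: for a minimiser `U♯` of the constrained minimal action over the datum `V₀` (all-data frame of the lineage),
`D²(minAct∘chart_{V₀})(0)[v,v] ≥ w(1 − Cε)·Σ_P nhsNormSq(curl_{V₀} ṽ P) − wCε‖ṽ‖²`, j-, N-uniform at `d = 4`.  ✓ H11 `NE7EffectiveFormLowerBoundSocket.effectiveForm_lower_bound_of_localLetter`
reduced it to ONE local letter — `|Dm(0)[D²Ψ(0)[X,X]]| ≤ w·C_Λ·(L⁻¹)^{2(j+1)}·dirSq X̃` on top-frame-free `X`, `Ψ` the STRIPPED constraint (frames removed exactly, ✓ H10) —; ✓ H14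
`NE7StrippedMultiplierLetterL1.dirL1_fderiv_fderiv_strippedConstraint_le` bounds the torus-ℓ¹ mass of `D²Ψ(0)[X,X]` by `128·C₁L²·4(4L+1)⁴·L^{−2j}·dirSq X̃` (row NE3's quadratic ℓ¹
tower + the Taylor extraction ✓ H13), and ✓ `NE7MultiplierDensity.multiplier_density_allData_uniform` gives `|Dm(0)[γ]| ≤ 2·curl1C·ε·‖γ‖_{ℓ¹}`.  THIS FILE multiplies the two
(**`stripped_multiplier_letter_allData`**: the letter with `C_Λ = 2·curl1C·ε·128·C₁L²·4(4L+1)⁴·L²`, for EVERY fine direction — no frame condition needed) and feeds H11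
(**`effectiveForm_lower_bound`**: (G′) with all constants explicit; hypotheses = H11's ε-lines, five more ε-lines (doubled Prop-2 lines, the radius lines of row NE3's ℓ¹ tower), and the
(ε, C_P)-line `C_Λ·2(4C_P·n) ≤ 1`).
WHAT ([folklore]; 0 def, 0 sorry; d = 4): **`radSum_class_le`**, **`stripped_multiplier_letter_allData`**, **`effectiveForm_lower_bound`**.
HONEST FRAMING (page 1): (G′) is an estimate ABOUT OUR lattice objects (the tree's constrained minimal action, block averaging tower and slice Poincaré hypothesis `SlicePoincare … C_P`,
which stays a displayed HYPOTHESIS of the statement as in H11∕G12); it is the lineage's target (row NE7's effective-form lower bound in the all-data frame), NOT Bałaban's NE7 as printed and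
NOT a spine node by itself; nothing of Bałaban's asserted; spine 0∕9; finite T⁴ rung (B)+1 — NOT continuum YM on ℝ⁴, NOT infinite volume, NOT mass gap, NOT BetaPertH, NOT Clay.
-/

set_option autoImplicit false

open scoped BigOperators Matrix Matrix.Norms.L2Operator Topology
open NormedSpace Finset Set Filter Metric

namespace Summit.QuantumFields.BalabanUV.T4Continuum.NE7EffectiveFormLowerBound

open Literature.MathematicalPhysics.QuantumFieldTheory.Balaban1983to89
open B7Prop1Explicit B7Prop2Explicit MatrixLog UnitaryModel
open T4AveragingDeficitWall (IsUnitaryCfg IsSkewDir SmallField Ad curl curlAt curlSq dirSq dirL1 fineAction)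
open T4AveragingDeficitWallBoundary (IsPeriodicCfg periodBox)
open AveragingDeficitTorusChart (TDir chart chartDir resDir extDir)
open AveragingDeficitTwoLevelPrep (twoLevelSmall skewSub skewPR)
open AveragingDeficitMultiLevelPrep (cavgIter tower levelQ levelQ' LevelSmall tower_ne_zero)
open AveragingDeficitMultiLevelBridge (tower_eq cavgIter_eq_avgIter)
open MatrixNorms (nhsNormSq)
open MinimalActionLevels (perWin stepWt)
open MinimalActionSandwich (IsMinimiser minAct)
open MinimalActionRate (sfClass)
open NE7RadIterUniform (radD radD_nonneg radIter_le_two_mul)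
open NE7StraightTowerCurlEnergy (eC mC)
open NE3QbarIterCovLiftPrep (cruxC)
open NE3RightInverseSolveLetters (thetaLoc)
open NE3SlicePoincareShape (SlicePoincare)
open NE3FrameFreeSliceW (frameFreeBlockLandauW)
open NE7SliceRepHessianFloor (liftMassC liftCurlC)
open NE3TangentCovariantTower (framePotW)
open NE3HatInvCurlLetters (curl1C curl1C_nonneg)
open ReplicationRightInverseBound (radSum radSum_le)
open AveragingDeficitMultiLevelPrep (radIter)
open BlockAverageVaryHolo (nbRad)
open NE3CovariantLineSumsError (Csup Csup_nonneg)
open ShellMeasureAverageProp4General (C1cov C1cov_pos)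
open NE3.SupplierB8SfClassPrep (pdev_le_of_smallField)
open NE7MinimalOrbitDatumContinuity (thresholds)
open NE7StrippedConstraintMap (strippedConstraint)
open NE7EffectiveFormLowerBoundSocket (effectiveForm_lower_bound_of_localLetter)
open NE7StrippedMultiplierLetterL1 (dirL1_fderiv_fderiv_strippedConstraint_le)
open NE7MultiplierDensity (multiplier_density_allData_uniform)
open NE7EffectiveFormCoarseCurlAllLevels (stepWt_four)

noncomputable section

variable {n : Type} [Fintype n] [DecidableEq n]

/-! ## §1 The radius line at `d = 4` -/

/-- **THE RADIUS SUM OF THE CLASS IS `≤ (8∕3)·ε·L⁻²`, j-UNIFORMLY**: for `x = ε∕(L^{j+1})²` and `4ε·radD·L⁻⁴ ≤ 1`, `radSum 4 L j x ≤ (8∕3)·ε·(L²)⁻¹`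
(`radSum ≤ (4∕3)·radIter` and `NE7RadIterUniform.radIter_le_two_mul`). [folklore] -/
theorem radSum_class_le {L : ℕ} (hL : 2 ≤ L) {ε : ℝ} (hε : 0 ≤ ε) (hD : 4 * ε * radD 4 L * (((L : ℝ) ^ 2)⁻¹) ^ 2 ≤ 1) (j : ℕ) :
    radSum 4 L j (ε / ((L : ℝ) ^ (j + 1)) ^ 2) ≤ 8 / 3 * ε * ((L : ℝ) ^ 2)⁻¹ := by
  have hL0 : (0 : ℝ) < L := by exact_mod_cast (show 0 < L by omega)
  have hx : 0 ≤ ε / ((L : ℝ) ^ (j + 1)) ^ 2 := by positivity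
  have hxc : ε / ((L : ℝ) ^ (j + 1)) ^ 2 ≤ ε * (((L : ℝ) ^ 2)⁻¹) ^ (1 + j) := by
    have e : ε / ((L : ℝ) ^ (j + 1)) ^ 2 = ε * (((L : ℝ) ^ 2)⁻¹) ^ (1 + j) := by
      rw [inv_pow, ← pow_mul, div_eq_mul_inv, ← pow_mul]; congr 2; ring
    rw [e]
  have h1 := radIter_le_two_mul (d := 4) hL hε hD 1 j hx hxc
  have h2 := radSum_le (d := 4) hL j hx
  rw [pow_one] at h1
  linarith

/-! ## §2 The local stripped multiplier letter, all-data frame -/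

set_option maxHeartbeats 400000 in
/-- **THE LOCAL STRIPPED MULTIPLIER LETTER** (all-data frame): for every minimiser `U♯` and EVERY fine skew direction `X`,
`|Dm(0)[D²Ψ(0)[X,X]]| ≤ (2·curl1C·ε·(128·C₁L²·4(4L+1)⁴·L²))·((L⁻¹)^{2(j+1)}·dirSq X̃ (periodBox (tower L N (j+1))))`. [folklore] -/
theorem stripped_multiplier_letter_allData [Nonempty n] {L : ℕ} [NeZero L] (hL : 2 ≤ L) :
    ∃ ε₀ : ℝ, 0 < ε₀ ∧ ∀ ε : ℝ, 0 < ε → ε ≤ ε₀ →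
      C0 4 * (2 * (3 * ε)) ≤ 1 / 3 → 4 * (2 * (3 * ε)) ≤ c2' 4 L →
      Real.exp (4 * (800 * (((4 : ℕ) : ℝ) + 1) ^ 2 * (((4 : ℕ) : ℝ) + 4)) * (3 * ε)) ≤ 3 / 2 →
      4 * ε * radD 4 L * (((L : ℝ) ^ 2)⁻¹) ^ 2 ≤ 1 →
      (16 * ((4 : ℝ) + 1) * ((4 : ℝ) + 4) * (L : ℝ) ^ 2 * Csup 4 L * (4 * (2 * (nbRad 4 L : ℝ) + 1) ^ 4)) * (8 / 3 * ε * ((L : ℝ) ^ 2)⁻¹) ≤ ((L : ℝ) / (L : ℝ) ^ 4) / 2 →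
      ∀ (N : ℕ) [NeZero N], 1 ≤ N → ∃ δV : ℝ, 0 < δV ∧ ∀ j : ℕ,
        ∀ V₀ ∈ {V : Site 4 → Fin 4 → (Matrix n n ℂ)ˣ | IsUnitaryCfg V ∧ IsPeriodicCfg V (N : ℤ) ∧ SmallField V δV},
        ∀ Us : Site 4 → Fin 4 → (Matrix n n ℂ)ˣ, IsMinimiser 4 (sfClass 4 L N ε) L N (j + 1) V₀ Us →
        ∀ X : ↥(skewSub 4 n (L * tower L N j)),
          |fderiv ℝ (fun y : ↥(skewSub 4 n N) => minAct 4 (sfClass 4 L N ε) L N (j + 1) (chart (ContinuousLinearMap.id ℝ (Matrix n n ℂ)) N V₀ (y : TDir 4 n N))) 0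
              (fderiv ℝ (fderiv ℝ (strippedConstraint L N j Us)) 0 X X)|
            ≤ (2 * curl1C 4 L * ε * (128 * (C1cov 4 * (L : ℝ) ^ 2 * (4 * (4 * (L : ℝ) + 1) ^ 4)) * (L : ℝ) ^ 2))
                * (((L : ℝ)⁻¹) ^ (2 * (j + 1))
                  * dirSq (chartDir (ContinuousLinearMap.id ℝ (Matrix n n ℂ)) (L * tower L N j) (X : TDir 4 n (L * tower L N j))) (periodBox (tower L N (j + 1)))) := by
  have hL1 : 1 ≤ L := le_trans (by norm_num) hL
  have hL0 : (0 : ℝ) < L := by exact_mod_cast (show 0 < L by omega)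
  obtain ⟨ε₁, hε₁, T⟩ := thresholds (n := n) hL
  obtain ⟨ε₂, hε₂, D⟩ := multiplier_density_allData_uniform (n := n) hL
  refine ⟨min ε₁ ε₂, lt_min hε₁ hε₂, fun ε hε hεle hα3 hα4 hroom hD hS N _ hN => ?_⟩
  have hεε₁ : ε ≤ ε₁ := hεle.trans (min_le_left _ _)
  obtain ⟨-, -, hls, -⟩ := T ε hε hεε₁
  obtain ⟨δV, hδV, Dall⟩ := D ε hε (hεle.trans (min_le_right _ _)) N hN
  refine ⟨δV, hδV, fun j V₀ hV₀ Us hUs X => ?_⟩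
  haveI : NeZero (L * tower L N j) := ⟨Nat.mul_ne_zero (NeZero.ne L) (tower_ne_zero L N j)⟩
  -- class facts for the minimiser
  have hUu : IsUnitaryCfg Us := hUs.mem.1.1
  have hUP : IsPeriodicCfg Us ((N * L ^ (j + 1) : ℕ) : ℤ) := hUs.mem.1.2.1
  have hUa : SmallField Us (ε / ((L : ℝ) ^ (j + 1)) ^ 2) := hUs.mem.1.2.2
  have hLp : 0 < (L : ℝ) ^ (j + 1) := by positivity
  have ha : 0 ≤ ε / ((L : ℝ) ^ (j + 1)) ^ 2 := by positivity
  have hα : 0 < 3 * ε := by positivity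
  have hxα : ε / ((L : ℝ) ^ (j + 1)) ^ 2 < 3 * ε * (((L : ℝ) ^ (j + 1))⁻¹) ^ 2 := by
    rw [inv_pow, ← div_eq_mul_inv]
    apply div_lt_div_of_pos_right _ (by positivity); linarith
  have h52 : pdev Us < 3 * ε * (((L : ℝ) ^ (j + 1))⁻¹) ^ 2 := (pdev_le_of_smallField ha hUa).trans_lt hxα
  -- the radius line of row NE3's ℓ¹ tower
  have hS1 : (16 * (4 + 1) * (4 + 4) * (L : ℝ) ^ 2 * Csup 4 L * (4 * (2 * nbRad 4 L + 1) ^ 4)) * radSum 4 L j (ε / ((L : ℝ) ^ (j + 1)) ^ 2)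
      ≤ ((L : ℝ) / (L : ℝ) ^ 4) / 2 := by
    have hr := radSum_class_le hL hε.le hD j
    have hC : 0 ≤ 16 * (4 + 1) * (4 + 4) * (L : ℝ) ^ 2 * Csup 4 L * (4 * (2 * nbRad 4 L + 1) ^ 4) := by
      have := Csup_nonneg 4 L; positivity
    refine le_trans (mul_le_mul_of_nonneg_left hr hC) (le_trans (le_of_eq ?_) hS)
    ring_nf
  -- the torus-ℓ¹ letter (H14) and the density
  have hΛ := dirL1_fderiv_fderiv_strippedConstraint_le (N := N) hL hN j hUu hUP ha (hls j) hUa hα hα3 hα4 h52 hroom (by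
    refine le_trans (le_of_eq ?_) hS1
    push_cast; ring) X
  have hdens := Dall j V₀ hV₀ Us hUs (fderiv ℝ (fderiv ℝ (strippedConstraint L N j Us)) 0 X X)
  have hc : 0 ≤ 2 * curl1C 4 L * ε := by have := curl1C_nonneg 4 L; positivity
  refine hdens.trans (le_trans (mul_le_mul_of_nonneg_left hΛ hc) (le_of_eq ?_))
  have hL' : (L : ℝ) ≠ 0 := hL0.ne'
  rw [Nat.add_sub_cancel]
  have e : (((L : ℝ) / (L : ℝ) ^ 4) * L) ^ j = (L : ℝ) ^ 2 * ((L : ℝ)⁻¹) ^ (2 * (j + 1)) := by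
    rw [show ((L : ℝ) / (L : ℝ) ^ 4) * L = ((L : ℝ)⁻¹) ^ 2 by field_simp, ← pow_mul]
    rw [show 2 * (j + 1) = 2 * j + 2 by ring, pow_add]
    field_simp
  rw [e]
  push_cast
  ring

/-! ## §3 (G′) -/

/-- **(G′), d = 4, j- AND N-UNIFORM** (see the module docstring; constants explicit; `C_Λ(ε) = 2·curl1C·ε·(128·C₁L²·4(4L+1)⁴·L²)`). [folklore] -/
theorem effectiveForm_lower_bound [Nonempty n] {L : ℕ} [NeZero L] (hL : 2 ≤ L) :
    ∃ ε₀ : ℝ, 0 < ε₀ ∧ ∀ ε : ℝ, 0 < ε → ε ≤ ε₀ →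
      4 * (2 * ε) * radD 4 L * (((L : ℝ) ^ 2)⁻¹) ^ 2 ≤ 1 → twoLevelSmall 4 L * (2 * (2 * ε) * ((L : ℝ) ^ 2)⁻¹) ≤ 1 →
      8 * (L : ℝ) * mC 4 L (Fintype.card n) * ε * ((L : ℝ) ^ 2)⁻¹ ≤ 1 → ε ≤ 1 → cruxC 4 L * ε < 1 → thetaLoc 4 L * ε ≤ 1 / 2 → 43584 * ε ≤ 1 / 2 →
      C0 4 * (2 * (3 * ε)) ≤ 1 / 3 → 4 * (2 * (3 * ε)) ≤ c2' 4 L →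
      Real.exp (4 * (800 * (((4 : ℕ) : ℝ) + 1) ^ 2 * (((4 : ℕ) : ℝ) + 4)) * (3 * ε)) ≤ 3 / 2 →
      4 * ε * radD 4 L * (((L : ℝ) ^ 2)⁻¹) ^ 2 ≤ 1 →
      (16 * ((4 : ℝ) + 1) * ((4 : ℝ) + 4) * (L : ℝ) ^ 2 * Csup 4 L * (4 * (2 * (nbRad 4 L : ℝ) + 1) ^ 4)) * (8 / 3 * ε * ((L : ℝ) ^ 2)⁻¹) ≤ ((L : ℝ) / (L : ℝ) ^ 4) / 2 →
      ∀ (N : ℕ) [NeZero N], 1 ≤ N → ∀ j : ℕ,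
      ∃ δV : ℝ, 0 < δV ∧
        ∀ V₀ ∈ {V : Site 4 → Fin 4 → (Matrix n n ℂ)ˣ | IsUnitaryCfg V ∧ IsPeriodicCfg V (N : ℤ) ∧ SmallField V δV},
        ∀ Us : Site 4 → Fin 4 → (Matrix n n ℂ)ˣ, IsMinimiser 4 (sfClass 4 L N ε) L N (j + 1) V₀ Us →
        ∀ CP : ℝ, 0 ≤ CP → SlicePoincare L (j + 1) Us (frameFreeBlockLandauW (d := 4) (n := n) L N (j + 1) Us) CP (periodBox (N * L ^ (j + 1))) →
        28 * (Fintype.card (T4AveragingDeficitWall.Plane 4) : ℝ) * ε * (4 * CP * Fintype.card n) ≤ 1 → ∀ θ : ℝ, 0 < θ →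
        (2 * curl1C 4 L * ε * (128 * (C1cov 4 * (L : ℝ) ^ 2 * (4 * (4 * (L : ℝ) + 1) ^ 4)) * (L : ℝ) ^ 2)) * (2 * (4 * CP * Fintype.card n)) ≤ 1 →
        ∀ v : ↥(skewSub 4 n N),
          (1 - (2 * curl1C 4 L * ε * (128 * (C1cov 4 * (L : ℝ) ^ 2 * (4 * (4 * (L : ℝ) + 1) ^ 4)) * (L : ℝ) ^ 2)) * (2 * (4 * CP * Fintype.card n)))
              * (((stepWt 4 L)⁻¹) ^ (j + 1) * ∑ P ∈ perWin 4 N, nhsNormSq (curl V₀ (chartDir (ContinuousLinearMap.id ℝ (Matrix n n ℂ)) N (v : TDir 4 n N)) P))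
            ≤ ((1 + θ) + 2 * ((1 + θ) * (14 * (Fintype.card (T4AveragingDeficitWall.Plane 4) : ℝ) * ε) + (1 + θ⁻¹) * (36 * eC 4 L (Fintype.card n) ^ 2 * ε ^ 2))
                    * (4 * CP * Fintype.card n))
                * fderiv ℝ (fderiv ℝ (fun y : ↥(skewSub 4 n N) => minAct 4 (sfClass 4 L N ε) L N (j + 1) (chart (ContinuousLinearMap.id ℝ (Matrix n n ℂ)) N V₀ (y : TDir 4 n N)))) 0 v v
              + ((stepWt 4 L)⁻¹) ^ (j + 1)
                * (2 * (((1 + θ) + 2 * ((1 + θ) * (14 * (Fintype.card (T4AveragingDeficitWall.Plane 4) : ℝ) * ε) + (1 + θ⁻¹) * (36 * eC 4 L (Fintype.card n) ^ 2 * ε ^ 2))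
                        * (4 * CP * Fintype.card n)))
                      * (2 * curl1C 4 L * ε * (128 * (C1cov 4 * (L : ℝ) ^ 2 * (4 * (4 * (L : ℝ) + 1) ^ 4)) * (L : ℝ) ^ 2)) * (2 * liftMassC 4 L + 4 * CP * liftCurlC 4 L)
                    + (1 - (2 * curl1C 4 L * ε * (128 * (C1cov 4 * (L : ℝ) ^ 2 * (4 * (4 * (L : ℝ) + 1) ^ 4)) * (L : ℝ) ^ 2)) * (2 * (4 * CP * Fintype.card n)))
                      * (2 * ((1 + θ) * (14 * (Fintype.card (T4AveragingDeficitWall.Plane 4) : ℝ) * ε) + (1 + θ⁻¹) * (36 * eC 4 L (Fintype.card n) ^ 2 * ε ^ 2))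
                        * (2 * liftMassC 4 L + 4 * CP * liftCurlC 4 L)))
                * dirSq (chartDir (ContinuousLinearMap.id ℝ (Matrix n n ℂ)) N (v : TDir 4 n N)) (periodBox N) := by
  obtain ⟨ε₁, hε₁, T⟩ := effectiveForm_lower_bound_of_localLetter (n := n) hL
  obtain ⟨ε₂, hε₂, S⟩ := stripped_multiplier_letter_allData (n := n) hL
  refine ⟨min ε₁ ε₂, lt_min hε₁ hε₂,
    fun ε hε hεle hεD2 hεT2 hεM hε1 hcrux hθl2 hEl hα3 hα4 hroom hD hS N _ hN j => ?_⟩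
  have hC0 : 0 ≤ C0 4 := by unfold C0; positivity
  have hα3' : C0 4 * (3 * ε) ≤ 1 / 3 := by nlinarith
  have hα4' : 4 * (3 * ε) ≤ c2' 4 L := by linarith
  obtain ⟨δ₁, hδ₁, T1⟩ := T ε hε (hεle.trans (min_le_left _ _)) hεD2 hεT2 hεM hε1 hcrux hθl2 hEl hα3' hα4' hroom N hN j
  obtain ⟨δ₂, hδ₂, S1⟩ := S ε hε (hεle.trans (min_le_right _ _)) hα3 hα4 hroom hD hS N hN
  refine ⟨min δ₁ δ₂, lt_min hδ₁ hδ₂, fun V₀ hV₀ Us hUs CP hCP hSP habs θ hθ hCΛa v => ?_⟩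
  obtain ⟨hV₀u, hV₀P, hV₀δ⟩ := hV₀
  have hV₀1 : V₀ ∈ {V : Site 4 → Fin 4 → (Matrix n n ℂ)ˣ | IsUnitaryCfg V ∧ IsPeriodicCfg V (N : ℤ) ∧ SmallField V δ₁} :=
    ⟨hV₀u, hV₀P, MinimalActionRate.SmallField.mono hV₀δ (min_le_left _ _)⟩
  have hV₀2 : V₀ ∈ {V : Site 4 → Fin 4 → (Matrix n n ℂ)ˣ | IsUnitaryCfg V ∧ IsPeriodicCfg V (N : ℤ) ∧ SmallField V δ₂} :=
    ⟨hV₀u, hV₀P, MinimalActionRate.SmallField.mono hV₀δ (min_le_right _ _)⟩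
  have hCΛ0 : 0 ≤ 2 * curl1C 4 L * ε * (128 * (C1cov 4 * (L : ℝ) ^ 2 * (4 * (4 * (L : ℝ) + 1) ^ 4)) * (L : ℝ) ^ 2) := by
    have := curl1C_nonneg 4 L; have := C1cov_pos 4; positivity
  have hw : ((stepWt 4 L)⁻¹) ^ (j + 1) = 1 := by rw [stepWt_four]; simp
  refine T1 V₀ hV₀1 Us hUs CP hCP hSP habs θ hθ _ hCΛ0 hCΛa (fun X _ => ?_) v
  rw [hw, one_mul]
  exact S1 j V₀ hV₀2 Us hUs X

end

end Summit.QuantumFields.BalabanUV.T4Continuum.NE7EffectiveFormLowerBound
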